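import Summits.QuantumFields.YangMills.Theorems.UnitScaleTiltProp8ChartDoubleBarStar
import Summits.QuantumFields.YangMills.Theorems.UnitScaleTiltProp8FlatPlaqDeriv
import HarnessLib

/-!
# Route `UnitScaleTilt`, crux K1 «MinimiserStabilityRegPr» (stmt-QuantumFields-19200), stub V2′ `stub_halvingStep` — pillar P3, the double-bar chart of record:
# **THE TRACE STRUCTURE OF `Q♭`: `Q♭(A − (tr∘A)•1) = Q♭(A) − tr(Q♭ A)•1`** — the determinant normalisation `σ : u ↦ (det u)⁻¹•u` of `GL₂(ℂ)` (multiplicative, scalars central, fixed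
# points `SL₂`) passes through `e^{iη·}`, transporters, `exp[mean log]`, the block frames, the (89) double-bar step and its iterate on the read territory (GUARDED: `‖U̿ − 1‖ ≤ 1∕12`);
# hence the small solution `Dsel X` of (49) at a bondwise-TRACELESS `X` is traceless (census row S11 `hU`, LOCATED ✗ 08:5xZ: ✓`exists_su2Chart` needs the DRESSED field traceless)

Cell `ym3-torus` (HUMAN RULING D-0037: YM₃ on the torus is ladder rung R3, not the Clay problem), width seat `ym-ust-19200-w8` g0∕s2.
`--supports stmt-QuantumFields-19200 --as helper`; definition-free, 0 sorry.  Companion of ✓`…ChartDoubleBarStar` (route (σ) of the LOCATE; same template `holT_rel_of_walk`).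

WHAT THIS FILE PROVES (no definition, no sorry; `M₂(ℂ)`, L²-operator norm):
* §1 **`mlog_detInv_smul`** — `log((det W)⁻¹•W) = log W − tr(log W)•1` for `‖W − 1‖ ≤ 1∕12` (Liouville `det e^G = e^{tr G}` ✓`det_exp_eq_exp_trace`, `log∘exp = id` below `ln 2`
  ✓`B7BlockAvgLog.mlog_exp`); `norm_sub_trace_smul_one_le` (`‖M − (tr M)•1‖ ≤ 3‖M‖`).
* §2 the relation `σ`: `sigma_one∕_mul∕_inv`, `sigma_emlUnit` (`eml(σ∘W) = σ(eml W)` on `1∕12`-small tuples), **`sigma_dbarAvgU`** (one (89) step, two-block near-flatness `48ℓs ≤ 1`),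
  **`sigma_dbarIterU_of_reads`** (tower, budget `30400·ℓ²·Lⁱ·s₀ ≤ 1`), base `coe_expCfg_traceProj` (`e^{iη(Y − tr Y•1)} = σ(e^{iηY})`).
* §3 ★★ **`chartLogFlat_traceProj_of_reads`** ∕ ★★ **`chartLogFlat_traceProj_weightedBall₀`**: `Q♭(A − (tr∘A)•1)(j,c) = Q♭(A)(j,c) − tr(Q♭(A)(j,c))•1`; **`fderiv_chartLogFlat_zero_traceProj`**
  (the same for `Q_lin`, CERT-2).
* §4 **`trace_dressed_eq_zero_of_unique`** (abstract (49) + uniqueness ⇒ `tr (Dv c) = 0` and the dressed field traceless; the competitor `Dv − (tr∘Dv)•1` must lie in the uniqueness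
  class — displayed, served by FILE E's SHARP (55) on the half-ball) and ★★ **`trace_dressed_chartOfRecord`** (`C♭ = Q♭ − Q_lin` in ✓p616882 FILE E's shapes).
HONEST SCOPE.  Bookkeeping over landed letters.  NOT a claim about the stub, the crux, the rung or the mass gap.

References: T. Bałaban, CMP **102** (1985) [Balaban1985Variational] (20), (47)–(49), p.307; CMP **109** (1987) [Balaban1987RG1] (0.4)–(0.9); CMP **98** (1985) [Balaban1985Averaging] (23), (89).
-/

set_option autoImplicit false

noncomputable section

open scoped BigOperators
open NormedSpace

namespace Summit.QuantumFields.YangMills.Theorems.Prop8ChartDoubleBar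

open Literature.MathematicalPhysics.QuantumFieldTheory.Balaban1983to89
open T4Continuum BlockAveraging AveragingRT ExpMeanLog MatrixLog
open B10Eq27TorusAxialLog (holT)
open B5Eq118OneStroke (iterBlockOf iterBlockOf_succ iterBlockOf_zero)
open B6SectADomainsV1 (Domains)
open B6SectAOperatorsV1 (BondIdx)
open T3ContinuumYM3Torus (T3Family)
open LatticeFieldCalculus (bondAvgIter)
open Summit.QuantumFields.YangMills.Theorems.FlatCubeOpsText (IsLevWeight)
open Summit.QuantumFields.YangMills.Theorems.Prop8Chart
open Literature.Analysis.Matrix (det_exp_eq_exp_trace)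
open B7BlockAvgLog (mlog_exp)
open FlatPlaqDeriv (norm_trace_le_two_mul)

variable {P : Params}

section Sigma

open scoped Matrix.Norms.L2Operator

/-! ## §1 The logarithm of the determinant normalisation -/

/-- `‖M − (tr M)•1‖ ≤ 3‖M‖` on `M₂(ℂ)` (`|tr M| ≤ 2‖M‖`). [folklore] -/
theorem norm_sub_trace_smul_one_le (M : Matrix (Fin 2) (Fin 2) ℂ) : ‖M - Matrix.trace M • (1 : Matrix (Fin 2) (Fin 2) ℂ)‖ ≤ 3 * ‖M‖ := by
  have h := norm_trace_le_two_mul M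
  calc ‖M - Matrix.trace M • (1 : Matrix (Fin 2) (Fin 2) ℂ)‖ ≤ ‖M‖ + ‖Matrix.trace M • (1 : Matrix (Fin 2) (Fin 2) ℂ)‖ := norm_sub_le _ _
    _ = ‖M‖ + ‖Matrix.trace M‖ := by rw [norm_smul, norm_one, mul_one]
    _ ≤ 3 * ‖M‖ := by linarith

/-- **`log((det W)⁻¹•W) = log W − tr(log W)•1`** for `‖W − 1‖ ≤ 1∕12`: with `G = log W`, `W = e^{G}`, `det W = e^{tr G}` (Liouville), `(det W)⁻¹•W = e^{G − tr G•1}` (the scalar commutes) and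
`‖G − tr G•1‖ ≤ 3‖G‖ ≤ 6‖W − 1‖ ≤ ½ < ln 2`. [cite: Balaban1985Averaging, (21)-(26) pp.21-22] -/
theorem mlog_detInv_smul {W : Matrix (Fin 2) (Fin 2) ℂ} (hW : ‖W - 1‖ ≤ 1 / 12) :
    mlog ((W.det)⁻¹ • W) = mlog W - Matrix.trace (mlog W) • (1 : Matrix (Fin 2) (Fin 2) ℂ) := by
  letI : NormedAlgebra ℚ (Matrix (Fin 2) (Fin 2) ℂ) := NormedAlgebra.restrictScalars ℚ ℂ _
  set G : Matrix (Fin 2) (Fin 2) ℂ := mlog W with hG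
  have hW1 : ‖W - 1‖ < 1 := lt_of_le_of_lt hW (by norm_num)
  have hexp : exp G = W := exp_mlog hW1
  have hGn : ‖G‖ ≤ 2 * ‖W - 1‖ := norm_mlog_le_two_mul (hW.trans (by norm_num))
  have hdet : W.det = Complex.exp (Matrix.trace G) := by
    rw [← hexp, det_exp_eq_exp_trace, Complex.exp_eq_exp_ℂ]
  have hcomm : Commute G (-(Matrix.trace G) • (1 : Matrix (Fin 2) (Fin 2) ℂ)) := (Commute.one_right G).smul_right _
  have hprod : (W.det)⁻¹ • W = exp (G - Matrix.trace G • (1 : Matrix (Fin 2) (Fin 2) ℂ)) := by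
    rw [sub_eq_add_neg, ← neg_smul, exp_add_of_commute hcomm, exp_smul_one_eq, hexp, hdet, ← Complex.exp_neg, Matrix.mul_smul, mul_one]
  have hsmall : ‖G - Matrix.trace G • (1 : Matrix (Fin 2) (Fin 2) ℂ)‖ < Real.log 2 := by
    have h3 := norm_sub_trace_smul_one_le G
    have := Real.log_two_gt_d9
    nlinarith [norm_nonneg (W - 1)]
  rw [hprod, mlog_exp hsmall]

/-! ## §2 The determinant normalisation through the double-bar tower -/

/-- `σ(1) = 1`. [folklore] -/
theorem sigma_one : (((1 : (Matrix (Fin 2) (Fin 2) ℂ)ˣ)) : Matrix (Fin 2) (Fin 2) ℂ) =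
    ((((1 : (Matrix (Fin 2) (Fin 2) ℂ)ˣ)) : Matrix (Fin 2) (Fin 2) ℂ).det)⁻¹ • (((1 : (Matrix (Fin 2) (Fin 2) ℂ)ˣ)) : Matrix (Fin 2) (Fin 2) ℂ) := by
  rw [Units.val_one, Matrix.det_one, inv_one, one_smul]

/-- `σ(ab) = σ(a)σ(b)` (the determinant is multiplicative and scalars are central). [folklore] -/
theorem sigma_mul {a b a' b' : (Matrix (Fin 2) (Fin 2) ℂ)ˣ}
    (ha : (a' : Matrix (Fin 2) (Fin 2) ℂ) = ((a : Matrix (Fin 2) (Fin 2) ℂ).det)⁻¹ • (a : Matrix (Fin 2) (Fin 2) ℂ))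
    (hb : (b' : Matrix (Fin 2) (Fin 2) ℂ) = ((b : Matrix (Fin 2) (Fin 2) ℂ).det)⁻¹ • (b : Matrix (Fin 2) (Fin 2) ℂ)) :
    ((a' * b' : (Matrix (Fin 2) (Fin 2) ℂ)ˣ) : Matrix (Fin 2) (Fin 2) ℂ) =
      (((a * b : (Matrix (Fin 2) (Fin 2) ℂ)ˣ) : Matrix (Fin 2) (Fin 2) ℂ).det)⁻¹ • ((a * b : (Matrix (Fin 2) (Fin 2) ℂ)ˣ) : Matrix (Fin 2) (Fin 2) ℂ) := by
  rw [Units.val_mul, Units.val_mul, ha, hb, Matrix.smul_mul, Matrix.mul_smul, smul_smul, Matrix.det_mul, mul_inv]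

/-- `σ(a⁻¹) = σ(a)⁻¹`. [folklore] -/
theorem sigma_inv {a a' : (Matrix (Fin 2) (Fin 2) ℂ)ˣ}
    (ha : (a' : Matrix (Fin 2) (Fin 2) ℂ) = ((a : Matrix (Fin 2) (Fin 2) ℂ).det)⁻¹ • (a : Matrix (Fin 2) (Fin 2) ℂ)) :
    ((a'⁻¹ : (Matrix (Fin 2) (Fin 2) ℂ)ˣ) : Matrix (Fin 2) (Fin 2) ℂ) =
      (((a⁻¹ : (Matrix (Fin 2) (Fin 2) ℂ)ˣ) : Matrix (Fin 2) (Fin 2) ℂ).det)⁻¹ • ((a⁻¹ : (Matrix (Fin 2) (Fin 2) ℂ)ˣ) : Matrix (Fin 2) (Fin 2) ℂ) := by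
  have hda : IsUnit (a : Matrix (Fin 2) (Fin 2) ℂ).det := (Matrix.isUnit_iff_isUnit_det _).1 a.isUnit
  have hne : (a : Matrix (Fin 2) (Fin 2) ℂ).det ≠ 0 := hda.ne_zero
  have hdinv : ((a⁻¹ : (Matrix (Fin 2) (Fin 2) ℂ)ˣ) : Matrix (Fin 2) (Fin 2) ℂ).det = ((a : Matrix (Fin 2) (Fin 2) ℂ).det)⁻¹ := by
    have h := congrArg Matrix.det a.mul_inv
    rw [Matrix.det_mul, Matrix.det_one] at h
    exact eq_inv_of_mul_eq_one_right h
  rw [hdinv, inv_inv]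
  refine Units.inv_eq_of_mul_eq_one_right ?_
  rw [ha, Matrix.smul_mul, Matrix.mul_smul, smul_smul, inv_mul_cancel₀ hne, one_smul, ← Units.val_mul, mul_inv_cancel, Units.val_one]

/-- **`σ` THROUGH `exp[mean log]`** on a `1∕12`-small tuple (at the level of the units `(isUnit_eml ·).unit`): `eml(σ∘W) = σ(eml W)`, since `log((det Wᵢ)⁻¹•Wᵢ) = log Wᵢ − tr(log Wᵢ)•1` and
`det(eml W) = e^{mean tr log Wᵢ}`. [cite: Balaban1987RG1, (0.4)-(0.9) p.253] -/
theorem sigma_emlUnit {W W' : Idx P → Matrix (Fin 2) (Fin 2) ℂ} (hW : ∀ i, ‖W i - 1‖ ≤ 1 / 12) (hσ : ∀ i, W' i = ((W i).det)⁻¹ • W i) :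
    (((isUnit_eml W').unit : (Matrix (Fin 2) (Fin 2) ℂ)ˣ) : Matrix (Fin 2) (Fin 2) ℂ) =
      ((((isUnit_eml W).unit : (Matrix (Fin 2) (Fin 2) ℂ)ˣ) : Matrix (Fin 2) (Fin 2) ℂ).det)⁻¹ • (((isUnit_eml W).unit : (Matrix (Fin 2) (Fin 2) ℂ)ˣ) : Matrix (Fin 2) (Fin 2) ℂ) := by
  letI : NormedAlgebra ℚ (Matrix (Fin 2) (Fin 2) ℂ) := NormedAlgebra.restrictScalars ℚ ℂ _
  rw [IsUnit.unit_spec, IsUnit.unit_spec, eml_eq_exp, eml_eq_exp]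
  set c : ℂ := ((Fintype.card (Idx P) : ℂ))⁻¹ with hc
  set m : ℂ := c * ∑ i, Matrix.trace (mlog (W i)) with hm
  -- the exponents
  have hsum : ∑ i, mlog (W' i) = ∑ i, mlog (W i) - (∑ i, Matrix.trace (mlog (W i))) • (1 : Matrix (Fin 2) (Fin 2) ℂ) := by
    rw [Finset.sum_smul, ← Finset.sum_sub_distrib]
    exact Finset.sum_congr rfl fun i _ => by rw [hσ i, mlog_detInv_smul (hW i)]
  have hexpo : c • ∑ i, mlog (W' i) = c • ∑ i, mlog (W i) + (-m) • (1 : Matrix (Fin 2) (Fin 2) ℂ) := by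
    rw [hsum, smul_sub, smul_smul, hm, neg_smul, sub_eq_add_neg]
  have hcomm : Commute (c • ∑ i, mlog (W i)) ((-m) • (1 : Matrix (Fin 2) (Fin 2) ℂ)) := (Commute.one_right _).smul_right _
  have hdet : (exp (c • ∑ i, mlog (W i))).det = Complex.exp m := by
    rw [det_exp_eq_exp_trace, Matrix.trace_smul, Matrix.trace_sum, Complex.exp_eq_exp_ℂ, hm, smul_eq_mul]
  rw [hexpo, exp_add_of_commute hcomm, exp_smul_one_eq, hdet, ← Complex.exp_neg, Matrix.mul_smul, mul_one]

/-- **ONE DOUBLE-BAR STEP COMMUTES WITH `σ`** on the two blocks of `c`: if `S′ = σ ∘ S` on the two-block bonds, which are within `s` of `1`, `48ℓs ≤ 1`, then `U̿′(c) = σ(U̿(c))`.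
[cite: Balaban1985Averaging, (89) p.31, (110) p.34; Balaban1987RG1, (0.4)-(0.9) p.253] -/
theorem sigma_dbarAvgU {j : ℕ} (hj : j + 1 ≤ P.m + P.K) {S S' : GaugeField P j (Matrix (Fin 2) (Fin 2) ℂ)ˣ} (c : PBond P (j + 1)) {s : ℝ} (hs0 : 0 ≤ s)
    (hℓs : 48 * (((P.d + 2) * P.L : ℕ) : ℝ) * s ≤ 1)
    (hS : ∀ b : PBond P j, (blockOf b.src = c.src ∨ blockOf b.src = c.tgt) → (blockOf b.tgt = c.src ∨ blockOf b.tgt = c.tgt) →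
      ‖((S b : (Matrix (Fin 2) (Fin 2) ℂ)ˣ) : Matrix (Fin 2) (Fin 2) ℂ) - 1‖ ≤ s)
    (hσ : ∀ b : PBond P j, (blockOf b.src = c.src ∨ blockOf b.src = c.tgt) → (blockOf b.tgt = c.src ∨ blockOf b.tgt = c.tgt) →
      ((S' b : (Matrix (Fin 2) (Fin 2) ℂ)ˣ) : Matrix (Fin 2) (Fin 2) ℂ) =
        (((S b : (Matrix (Fin 2) (Fin 2) ℂ)ˣ) : Matrix (Fin 2) (Fin 2) ℂ).det)⁻¹ • ((S b : (Matrix (Fin 2) (Fin 2) ℂ)ˣ) : Matrix (Fin 2) (Fin 2) ℂ)) :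
    ((dbarAvgU S' c : (Matrix (Fin 2) (Fin 2) ℂ)ˣ) : Matrix (Fin 2) (Fin 2) ℂ) =
      ((((dbarAvgU S c : (Matrix (Fin 2) (Fin 2) ℂ)ˣ) : Matrix (Fin 2) (Fin 2) ℂ)).det)⁻¹ • ((dbarAvgU S c : (Matrix (Fin 2) (Fin 2) ℂ)ˣ) : Matrix (Fin 2) (Fin 2) ℂ) := by
  have hℓ0 : 0 ≤ (((P.d + 2) * P.L : ℕ) : ℝ) * s := by positivity
  have hℓs4 : 4 * (((P.d + 2) * P.L : ℕ) : ℝ) * s ≤ 1 := by linarith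
  have htw : 4 * (((P.d + 2) * P.L : ℕ) : ℝ) * s ≤ 1 / 12 := by linarith
  -- `σ` along walks that read related bonds
  have hwalk : ∀ (x : Site P j) (w : List (Letter P.d)),
      (∀ st ∈ walk x w, ((S' st.bond : (Matrix (Fin 2) (Fin 2) ℂ)ˣ) : Matrix (Fin 2) (Fin 2) ℂ) =
        (((S st.bond : (Matrix (Fin 2) (Fin 2) ℂ)ˣ) : Matrix (Fin 2) (Fin 2) ℂ).det)⁻¹ • ((S st.bond : (Matrix (Fin 2) (Fin 2) ℂ)ˣ) : Matrix (Fin 2) (Fin 2) ℂ)) →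
      ((holT S' x w : (Matrix (Fin 2) (Fin 2) ℂ)ˣ) : Matrix (Fin 2) (Fin 2) ℂ) =
        (((holT S x w : (Matrix (Fin 2) (Fin 2) ℂ)ˣ) : Matrix (Fin 2) (Fin 2) ℂ).det)⁻¹ • ((holT S x w : (Matrix (Fin 2) (Fin 2) ℂ)ˣ) : Matrix (Fin 2) (Fin 2) ℂ) :=
    fun x w hw => holT_rel_of_walk
      (fun (a a' : (Matrix (Fin 2) (Fin 2) ℂ)ˣ) => (a' : Matrix (Fin 2) (Fin 2) ℂ) = ((a : Matrix (Fin 2) (Fin 2) ℂ).det)⁻¹ • (a : Matrix (Fin 2) (Fin 2) ℂ))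
      sigma_one (fun _ _ _ _ ha hb => sigma_mul ha hb) (fun _ _ ha => sigma_inv ha) S S' x w hw
  -- the frames at the two ends
  have hframe : ∀ y : Site P (j + 1), (y = c.src ∨ y = c.tgt) →
      ((vframeU S' y : (Matrix (Fin 2) (Fin 2) ℂ)ˣ) : Matrix (Fin 2) (Fin 2) ℂ) =
        (((vframeU S y : (Matrix (Fin 2) (Fin 2) ℂ)ˣ) : Matrix (Fin 2) (Fin 2) ℂ).det)⁻¹ • ((vframeU S y : (Matrix (Fin 2) (Fin 2) ℂ)ˣ) : Matrix (Fin 2) (Fin 2) ℂ) := by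
    intro y hy
    have hSy : ∀ b : PBond P j, blockOf b.src = y → blockOf b.tgt = y → ‖((S b : (Matrix (Fin 2) (Fin 2) ℂ)ˣ) : Matrix (Fin 2) (Fin 2) ℂ) - 1‖ ≤ s := by
      intro b hb1 hb2
      exact hS b (by rw [hb1]; exact hy) (by rw [hb2]; exact hy)
    refine sigma_emlUnit (fun i => ((norm_holT_stair_sub_one_le hj y hs0 hℓs4 hSy i).1).trans htw) fun i => ?_
    refine hwalk _ _ fun st hst => hσ st.bond ?_ ?_
    · rw [(blockOf_ends_of_mem_stairWalk hj y i.1 i.2.1 st hst).1]; exact hy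
    · rw [(blockOf_ends_of_mem_stairWalk hj y i.1 i.2.1 st hst).2]; exact hy
  -- the single-bar average
  have havg : ((emlAvgU S' c : (Matrix (Fin 2) (Fin 2) ℂ)ˣ) : Matrix (Fin 2) (Fin 2) ℂ) =
      (((emlAvgU S c : (Matrix (Fin 2) (Fin 2) ℂ)ˣ) : Matrix (Fin 2) (Fin 2) ℂ).det)⁻¹ • ((emlAvgU S c : (Matrix (Fin 2) (Fin 2) ℂ)ˣ) : Matrix (Fin 2) (Fin 2) ℂ) := by
    unfold emlAvgU
    refine sigma_mul (sigma_emlUnit (fun i => ((norm_loopHolU_sub_one_le hj c hs0 hℓs4 hS i).1).trans htw) fun i => ?_) ?_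
    · exact hwalk _ _ fun st hst => hσ st.bond (two_block_of_mem_loopWalk hj c i hst).1 (two_block_of_mem_loopWalk hj c i hst).2
    · exact hwalk _ _ fun st hst => hσ st.bond (two_block_of_mem_lineWalk hj c hst).1 (two_block_of_mem_lineWalk hj c hst).2
  rw [dbarAvgU_apply, dbarAvgU_apply]
  exact sigma_mul (sigma_mul (sigma_inv (hframe c.src (Or.inl rfl))) havg) (hframe c.tgt (Or.inr rfl))

/-- **THE DOUBLE-BAR TOWER COMMUTES WITH `σ` ON THE READ TERRITORY** (budget `30400·ℓ²·Lⁱ·s₀ ≤ 1`, `U′ = σ ∘ U` and `U` within `s₀` of `1` on the reads).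
[cite: Balaban1985Averaging, Prop. 4 (134)-(135) p.38; Balaban1987RG1, (0.9) p.253] -/
theorem sigma_dbarIterU_of_reads :
    ∀ (i : ℕ), i ≤ P.m + P.K → ∀ (S : Set (Site P i)) (U U' : GaugeField P 0 (Matrix (Fin 2) (Fin 2) ℂ)ˣ) (s₀ : ℝ), 0 ≤ s₀ →
      8 * 3800 * (((P.d + 2) * P.L : ℕ) : ℝ) ^ 2 * (P.L : ℝ) ^ i * s₀ ≤ 1 →
      (∀ b : PBond P 0, iterBlockOf i b.src ∈ S → iterBlockOf i b.tgt ∈ S → ‖((U b : (Matrix (Fin 2) (Fin 2) ℂ)ˣ) : Matrix (Fin 2) (Fin 2) ℂ) - 1‖ ≤ s₀) →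
      (∀ b : PBond P 0, iterBlockOf i b.src ∈ S → iterBlockOf i b.tgt ∈ S →
        ((U' b : (Matrix (Fin 2) (Fin 2) ℂ)ˣ) : Matrix (Fin 2) (Fin 2) ℂ) =
          (((U b : (Matrix (Fin 2) (Fin 2) ℂ)ˣ) : Matrix (Fin 2) (Fin 2) ℂ).det)⁻¹ • ((U b : (Matrix (Fin 2) (Fin 2) ℂ)ˣ) : Matrix (Fin 2) (Fin 2) ℂ)) →
      ∀ e : PBond P i, e.src ∈ S → e.tgt ∈ S →
        ((dbarIterU i U' e : (Matrix (Fin 2) (Fin 2) ℂ)ˣ) : Matrix (Fin 2) (Fin 2) ℂ) =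
          (((dbarIterU i U e : (Matrix (Fin 2) (Fin 2) ℂ)ˣ) : Matrix (Fin 2) (Fin 2) ℂ).det)⁻¹ • ((dbarIterU i U e : (Matrix (Fin 2) (Fin 2) ℂ)ˣ) : Matrix (Fin 2) (Fin 2) ℂ) := by
  set ℓ : ℝ := (((P.d + 2) * P.L : ℕ) : ℝ) with hℓ
  have hℓ1 : (1 : ℝ) ≤ ℓ := by
    rw [hℓ]; exact_mod_cast Nat.one_le_iff_ne_zero.mpr (Nat.mul_ne_zero (by omega) (by have := P.hL.2; omega))
  have hL1 : (1 : ℝ) ≤ P.L := by exact_mod_cast P.L_pos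
  intro i
  induction i with
  | zero =>
    intro _ S U U' s₀ _ _ _ hσ e hs ht
    rw [dbarIterU_zero, dbarIterU_zero]
    exact hσ e (by simpa only [iterBlockOf_zero] using hs) (by simpa only [iterBlockOf_zero] using ht)
  | succ i ih =>
    intro hi S U U' s₀ hs₀ hbudget hU hσ c hcs hct
    have hbudget_i : 8 * 3800 * ℓ ^ 2 * (P.L : ℝ) ^ i * s₀ ≤ 1 := by
      refine le_trans ?_ hbudget
      have : (P.L : ℝ) ^ i ≤ (P.L : ℝ) ^ (i + 1) := pow_le_pow_right₀ hL1 (Nat.le_succ i)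
      have h0 : 0 ≤ 8 * 3800 * ℓ ^ 2 * s₀ := by positivity
      nlinarith
    set S' : Set (Site P i) := {y | blockOf y ∈ S} with hS'
    have hU' : ∀ b : PBond P 0, iterBlockOf i b.src ∈ S' → iterBlockOf i b.tgt ∈ S' →
        ‖((U b : (Matrix (Fin 2) (Fin 2) ℂ)ˣ) : Matrix (Fin 2) (Fin 2) ℂ) - 1‖ ≤ s₀ :=
      fun b hs ht => hU b (by rw [iterBlockOf_succ]; exact hs) (by rw [iterBlockOf_succ]; exact ht)
    have hσ' : ∀ b : PBond P 0, iterBlockOf i b.src ∈ S' → iterBlockOf i b.tgt ∈ S' →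
        ((U' b : (Matrix (Fin 2) (Fin 2) ℂ)ˣ) : Matrix (Fin 2) (Fin 2) ℂ) =
          (((U b : (Matrix (Fin 2) (Fin 2) ℂ)ˣ) : Matrix (Fin 2) (Fin 2) ℂ).det)⁻¹ • ((U b : (Matrix (Fin 2) (Fin 2) ℂ)ˣ) : Matrix (Fin 2) (Fin 2) ℂ) :=
      fun b hs ht => hσ b (by rw [iterBlockOf_succ]; exact hs) (by rw [iterBlockOf_succ]; exact ht)
    have hF := ih (Nat.le_of_succ_le hi) S' U U' s₀ hs₀ hbudget_i hU' hσ'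
    have hnear : ∀ e : PBond P i, e.src ∈ S' → e.tgt ∈ S' →
        ‖((dbarIterU i U e : (Matrix (Fin 2) (Fin 2) ℂ)ˣ) : Matrix (Fin 2) (Fin 2) ℂ) - 1‖ ≤ 2 * ((P.L : ℝ) ^ i * s₀) :=
      fun e hs ht => norm_dbarIterU_sub_one_le_two_mul₀ (Nat.le_of_succ_le hi) S' U hs₀ hbudget_i hU' e hs ht
    rw [dbarIterU_succ, dbarIterU_succ]
    have hmem : ∀ b : PBond P i, (blockOf b.src = c.src ∨ blockOf b.src = c.tgt) → (blockOf b.tgt = c.src ∨ blockOf b.tgt = c.tgt) →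
        b.src ∈ S' ∧ b.tgt ∈ S' := by
      intro b hbs hbt
      refine ⟨show blockOf b.src ∈ S from ?_, show blockOf b.tgt ∈ S from ?_⟩
      · rcases hbs with h | h <;> rw [h]; exacts [hcs, hct]
      · rcases hbt with h | h <;> rw [h]; exacts [hcs, hct]
    have h2x : 0 ≤ 2 * ((P.L : ℝ) ^ i * s₀) := by positivity
    have h48 : 48 * (((P.d + 2) * P.L : ℕ) : ℝ) * (2 * ((P.L : ℝ) ^ i * s₀)) ≤ 1 := by
      rw [← hℓ]
      have hx0 : 0 ≤ (P.L : ℝ) ^ i * s₀ := by positivity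
      have hb' : 8 * 3800 * ℓ ^ 2 * ((P.L : ℝ) ^ i * s₀) ≤ 1 := by
        have : 8 * 3800 * ℓ ^ 2 * ((P.L : ℝ) ^ i * s₀) = 8 * 3800 * ℓ ^ 2 * (P.L : ℝ) ^ i * s₀ := by ring
        rw [this]; exact hbudget_i
      nlinarith [mul_le_mul_of_nonneg_right hℓ1 (by positivity : (0 : ℝ) ≤ ℓ * ((P.L : ℝ) ^ i * s₀))]
    exact sigma_dbarAvgU hi c h2x h48 (fun b hbs hbt => hnear b (hmem b hbs hbt).1 (hmem b hbs hbt).2)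
      fun b hbs hbt => hF b (hmem b hbs hbt).1 (hmem b hbs hbt).2

/-- **`e^{iη(A(b) − tr A(b)•1)} = σ(e^{iηA(b)})`** (`det e^{X} = e^{tr X}`, the scalar commutes). [cite: Balaban1985Variational, (152) p.301, p.307] -/
theorem coe_expCfg_traceProj (η : ℝ) (A : PBond P 0 → Matrix (Fin 2) (Fin 2) ℂ) (b : PBond P 0) :
    ((expCfg η (fun b => A b - Matrix.trace (A b) • (1 : Matrix (Fin 2) (Fin 2) ℂ)) b : (Matrix (Fin 2) (Fin 2) ℂ)ˣ) : Matrix (Fin 2) (Fin 2) ℂ) =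
      ((((expCfg η A b : (Matrix (Fin 2) (Fin 2) ℂ)ˣ)) : Matrix (Fin 2) (Fin 2) ℂ).det)⁻¹ • (((expCfg η A b : (Matrix (Fin 2) (Fin 2) ℂ)ˣ)) : Matrix (Fin 2) (Fin 2) ℂ) := by
  letI : NormedAlgebra ℚ (Matrix (Fin 2) (Fin 2) ℂ) := NormedAlgebra.restrictScalars ℚ ℂ _
  have hcomm : Commute ((Complex.I * (η : ℂ)) • A b) (-((Complex.I * (η : ℂ)) * Matrix.trace (A b)) • (1 : Matrix (Fin 2) (Fin 2) ℂ)) :=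
    (Commute.one_right _).smul_right _
  rw [coe_expCfg, coe_expCfg]
  have hdet : (exp ((Complex.I * (η : ℂ)) • A b)).det = Complex.exp ((Complex.I * (η : ℂ)) * Matrix.trace (A b)) := by
    rw [det_exp_eq_exp_trace, Matrix.trace_smul, smul_eq_mul, Complex.exp_eq_exp_ℂ]
  rw [hdet, ← Complex.exp_neg, smul_sub, smul_smul, sub_eq_add_neg, ← neg_smul, exp_add_of_commute hcomm, exp_smul_one_eq, Matrix.mul_smul, mul_one]

/-! ## §3 The trace structure of the double-bar chart -/

/-- **`Q♭(A − (tr∘A)•1)(j,c) = Q♭(A)(j,c) − tr(Q♭(A)(j,c))•1` (index form, guarded)** under the read-territory budget of ✓`norm_chartLogFlat_apply_le_of_reads` (B1 plugged).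
[cite: Balaban1985Variational, (20) p.281, (47) p.285, p.307] -/
theorem chartLogFlat_traceProj_of_reads (η : ℝ) (D : Domains P) (idx : BondIdx D) (A₀ : PBond P 0 → Matrix (Fin 2) (Fin 2) ℂ) {s₀ : ℝ} (hs₀ : 0 ≤ s₀)
    (hbudget : 8 * 3800 * (((P.d + 2) * P.L : ℕ) : ℝ) ^ 2 * (P.L : ℝ) ^ (idx.1.1 : ℕ) * s₀ ≤ 1)
    (hA : ∀ b : PBond P 0, (iterBlockOf (idx.1.1 : ℕ) b.src = idx.1.2.src ∨ iterBlockOf (idx.1.1 : ℕ) b.src = idx.1.2.tgt) →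
      (iterBlockOf (idx.1.1 : ℕ) b.tgt = idx.1.2.src ∨ iterBlockOf (idx.1.1 : ℕ) b.tgt = idx.1.2.tgt) →
      ‖((expCfg η A₀ b : (Matrix (Fin 2) (Fin 2) ℂ)ˣ) : Matrix (Fin 2) (Fin 2) ℂ) - 1‖ ≤ s₀) :
    chartLogFlat η D (fun b => A₀ b - Matrix.trace (A₀ b) • (1 : Matrix (Fin 2) (Fin 2) ℂ)) idx =
      chartLogFlat η D A₀ idx - Matrix.trace (chartLogFlat η D A₀ idx) • (1 : Matrix (Fin 2) (Fin 2) ℂ) := by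
  have hj : (idx.1.1 : ℕ) ≤ P.m + P.K := (Nat.lt_succ_iff.mp idx.1.1.isLt).trans D.hk
  set S : Set (Site P (idx.1.1 : ℕ)) := {y | y = idx.1.2.src ∨ y = idx.1.2.tgt} with hS
  have hA' : ∀ b : PBond P 0, iterBlockOf (idx.1.1 : ℕ) b.src ∈ S → iterBlockOf (idx.1.1 : ℕ) b.tgt ∈ S →
      ‖((expCfg η A₀ b : (Matrix (Fin 2) (Fin 2) ℂ)ˣ) : Matrix (Fin 2) (Fin 2) ℂ) - 1‖ ≤ s₀ := fun b hs ht => hA b hs ht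
  have hσ := sigma_dbarIterU_of_reads (idx.1.1 : ℕ) hj S (expCfg η A₀) (expCfg η fun b => A₀ b - Matrix.trace (A₀ b) • (1 : Matrix (Fin 2) (Fin 2) ℂ))
    s₀ hs₀ hbudget hA' (fun b _ _ => coe_expCfg_traceProj η A₀ b) idx.1.2 (Or.inl rfl) (Or.inr rfl)
  have hnear := norm_dbarIterU_sub_one_le_two_mul₀ hj S (expCfg η A₀) hs₀ hbudget hA' idx.1.2 (Or.inl rfl) (Or.inr rfl)
  have hℓ1 : (1 : ℝ) ≤ (((P.d + 2) * P.L : ℕ) : ℝ) := by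
    exact_mod_cast Nat.one_le_iff_ne_zero.mpr (Nat.mul_ne_zero (by omega) (by have := P.hL.2; omega))
  have htw : ‖((dbarIterU (idx.1.1 : ℕ) (expCfg η A₀) idx.1.2 : (Matrix (Fin 2) (Fin 2) ℂ)ˣ) : Matrix (Fin 2) (Fin 2) ℂ) - 1‖ ≤ 1 / 12 := by
    refine hnear.trans ?_
    have h0 : 0 ≤ (P.L : ℝ) ^ (idx.1.1 : ℕ) * s₀ := by positivity
    have h1 : 8 * 3800 * (((P.d + 2) * P.L : ℕ) : ℝ) ^ 2 * ((P.L : ℝ) ^ (idx.1.1 : ℕ) * s₀) ≤ 1 := by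
      have : 8 * 3800 * (((P.d + 2) * P.L : ℕ) : ℝ) ^ 2 * ((P.L : ℝ) ^ (idx.1.1 : ℕ) * s₀) =
          8 * 3800 * (((P.d + 2) * P.L : ℕ) : ℝ) ^ 2 * (P.L : ℝ) ^ (idx.1.1 : ℕ) * s₀ := by ring
      rw [this]; exact hbudget
    nlinarith [(one_le_pow₀ (M₀ := ℝ) hℓ1 : (1:ℝ) ≤ _ ^ 2)]
  rw [chartLogFlat_apply, chartLogFlat_apply, hσ, mlog_detInv_smul htw, smul_sub, Matrix.trace_smul, smul_eq_mul, mul_smul]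

/-- **`Q_lin(A − (tr∘A)•1) = Q_lin(A) − tr(Q_lin A)•1`**: the linear part `η·Lʲ·Q_j` (CERT-2) commutes with the traceless projection. [cite: Balaban1985Variational, (48) p.285] -/
theorem fderiv_chartLogFlat_zero_traceProj (η : ℝ) (D : Domains P) (Y : PBond P 0 → Matrix (Fin 2) (Fin 2) ℂ) (idx : BondIdx D) :
    fderiv ℂ (chartLogFlat η D : (PBond P 0 → Matrix (Fin 2) (Fin 2) ℂ) → BondIdx D → Matrix (Fin 2) (Fin 2) ℂ) 0
        (fun b => Y b - Matrix.trace (Y b) • (1 : Matrix (Fin 2) (Fin 2) ℂ)) idx =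
      fderiv ℂ (chartLogFlat η D : (PBond P 0 → Matrix (Fin 2) (Fin 2) ℂ) → BondIdx D → Matrix (Fin 2) (Fin 2) ℂ) 0 Y idx -
        Matrix.trace (fderiv ℂ (chartLogFlat η D : (PBond P 0 → Matrix (Fin 2) (Fin 2) ℂ) → BondIdx D → Matrix (Fin 2) (Fin 2) ℂ) 0 Y idx) •
          (1 : Matrix (Fin 2) (Fin 2) ℂ) := by
  let π : Matrix (Fin 2) (Fin 2) ℂ →ₗ[ℝ] Matrix (Fin 2) (Fin 2) ℂ :=
    { toFun := fun M => M - Matrix.trace M • (1 : Matrix (Fin 2) (Fin 2) ℂ)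
      map_add' := fun M N => by rw [Matrix.trace_add, add_smul]; abel
      map_smul' := fun r M => by rw [Matrix.trace_smul, RingHom.id_apply, smul_sub, smul_assoc] }
  have hπ : (fun b => Y b - Matrix.trace (Y b) • (1 : Matrix (Fin 2) (Fin 2) ℂ)) = fun b => π (Y b) := rfl
  rw [fderiv_chartLogFlat_zero_apply, fderiv_chartLogFlat_zero_apply, hπ, ChartHInv.bondAvgIter_comp_apply π]
  show ((η : ℂ) * ((P.L : ℕ) : ℂ) ^ (idx.1.1 : ℕ)) • (bondAvgIter (idx.1.1 : ℕ) Y idx.1.2 - Matrix.trace (bondAvgIter (idx.1.1 : ℕ) Y idx.1.2) • (1 : Matrix (Fin 2) (Fin 2) ℂ)) =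
    ((η : ℂ) * ((P.L : ℕ) : ℂ) ^ (idx.1.1 : ℕ)) • bondAvgIter (idx.1.1 : ℕ) Y idx.1.2 -
      Matrix.trace (((η : ℂ) * ((P.L : ℕ) : ℂ) ^ (idx.1.1 : ℕ)) • bondAvgIter (idx.1.1 : ℕ) Y idx.1.2) • (1 : Matrix (Fin 2) (Fin 2) ℂ)
  rw [smul_sub, Matrix.trace_smul, smul_eq_mul, smul_smul]

/-- ★★ **`Q♭(A − (tr∘A)•1) = Q♭(A) − tr(Q♭ A)•1` ON THE WEIGHTED BALL OF RECORD** (letters of ✓`norm_chartLogFlat_le_weightedBall₀`), at every index.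
[cite: Balaban1985Variational, (20) p.281, (44)-(47) p.285, p.307] -/
theorem chartLogFlat_traceProj_weightedBall₀ (F : T3Family) (n K : ℕ) (D : Domains (F.P K)) (hDk : D.k = K - n)
    (hcollar : ∀ (i : ℕ) (e : PBond (F.P K) (i + 1)), D.LamBond (i + 1) e → ∀ z : Site (F.P K) i, (blockOf z = e.src ∨ blockOf z = e.tgt) → z ∈ D.Om i)
    {w : ℕ → PBond (F.P K) 0 → ℝ} (hw : IsLevWeight F n K D w)
    {R : ℝ} (hR : 16 * 3800 * ((((F.P K).d + 2) * (F.P K).L : ℕ) : ℝ) ^ 2 * (F.L : ℝ) * R ≤ 1)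
    {A : PBond (F.P K) 0 → Matrix (Fin 2) (Fin 2) ℂ} (hA : ∀ b, w 1 b * ‖A b‖ < R) (idx : BondIdx D) :
    chartLogFlat (((F.L : ℝ)⁻¹) ^ (K - n)) D (fun b => A b - Matrix.trace (A b) • (1 : Matrix (Fin 2) (Fin 2) ℂ)) idx =
      chartLogFlat (((F.L : ℝ)⁻¹) ^ (K - n)) D A idx - Matrix.trace (chartLogFlat (((F.L : ℝ)⁻¹) ^ (K - n)) D A idx) • (1 : Matrix (Fin 2) (Fin 2) ℂ) := by
  have hL1 : (1 : ℝ) ≤ F.L := by exact_mod_cast (F.P K).L_pos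
  have hL0 : (0 : ℝ) < F.L := by linarith
  have hℓ1 : (1 : ℝ) ≤ ((((F.P K).d + 2) * (F.P K).L : ℕ) : ℝ) := by
    exact_mod_cast Nat.one_le_iff_ne_zero.mpr (Nat.mul_ne_zero (by omega) (by have := (F.P K).hL.2; omega))
  have hLj : 0 < (F.L : ℝ) ^ (idx.1.1 : ℕ) := by positivity
  have hR0 : 0 ≤ R := by
    have := hA (⟨fun _ => 0, idx.1.2.dir⟩ : PBond (F.P K) 0)
    have hw0 : 0 ≤ w 1 ⟨fun _ => 0, idx.1.2.dir⟩ * ‖A ⟨fun _ => 0, idx.1.2.dir⟩‖ := by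
      rw [hw 1, pow_one]; exact mul_nonneg (by positivity) (norm_nonneg _)
    linarith
  have hLR : (F.L : ℝ) * R ≤ 1 := by
    have h16 : (1 : ℝ) ≤ 16 * 3800 * ((((F.P K).d + 2) * (F.P K).L : ℕ) : ℝ) ^ 2 := by
      nlinarith [(one_le_pow₀ (M₀ := ℝ) hℓ1 : (1:ℝ) ≤ _ ^ 2)]
    nlinarith [mul_nonneg hL0.le hR0]
  set s₀ : ℝ := 2 * (F.L : ℝ) * R * ((F.L : ℝ) ^ (idx.1.1 : ℕ))⁻¹ with hs₀
  have hs₀0 : 0 ≤ s₀ := by positivity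
  have hbudget : 8 * 3800 * ((((F.P K).d + 2) * (F.P K).L : ℕ) : ℝ) ^ 2 * (F.L : ℝ) ^ (idx.1.1 : ℕ) * s₀ ≤ 1 := by
    have : 8 * 3800 * ((((F.P K).d + 2) * (F.P K).L : ℕ) : ℝ) ^ 2 * (F.L : ℝ) ^ (idx.1.1 : ℕ) * s₀ =
        16 * 3800 * ((((F.P K).d + 2) * (F.P K).L : ℕ) : ℝ) ^ 2 * (F.L : ℝ) * R := by
      rw [hs₀]; field_simp; ring
    rw [this]; exact hR
  have hA' : ∀ b : PBond (F.P K) 0, (iterBlockOf (idx.1.1 : ℕ) b.src = idx.1.2.src ∨ iterBlockOf (idx.1.1 : ℕ) b.src = idx.1.2.tgt) →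
      (iterBlockOf (idx.1.1 : ℕ) b.tgt = idx.1.2.src ∨ iterBlockOf (idx.1.1 : ℕ) b.tgt = idx.1.2.tgt) →
      ‖((expCfg (((F.L : ℝ)⁻¹) ^ (K - n)) A b : (Matrix (Fin 2) (Fin 2) ℂ)ˣ) : Matrix (Fin 2) (Fin 2) ℂ) - 1‖ ≤ s₀ :=
    fun b hb _ => norm_expCfg_sub_one_le_of_weightedBall_flat F n K D hDk hcollar hw hLR hA idx b hb
  have hLF : ((F.P K).L : ℝ) = F.L := by norm_cast
  exact chartLogFlat_traceProj_of_reads (((F.L : ℝ)⁻¹) ^ (K - n)) D idx A hs₀0 (by rw [hLF]; exact hbudget) hA'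

/-! ## §4 The `hU` adapter: the unique small solution of (49) at a traceless field is traceless -/

/-- **THE `hU` ADAPTER (abstract (49) + uniqueness)**: if the remainder map `C` commutes with the traceless projection `π(M) = M − (tr M)•1` at the dressed point `A′ − Hs Dv`, `Hs` commutes
with it, `A′` is bondwise traceless, `Dv` solves (49) `C(A′ − Hs Dv) = Dv`, it is the unique solution of size `≤ t` AND `π ∘ Dv` has size `≤ t` too (the displayed half-ball condition,
`‖π M‖ ≤ 3‖M‖`), then `Dv` and the dressed field `A′ − Hs Dv` are traceless. [cite: Balaban1985Variational, (47)-(49) pp.285-286, p.307] -/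
theorem trace_dressed_eq_zero_of_unique {ι κ : Type*} (Hs : (κ → Matrix (Fin 2) (Fin 2) ℂ) → (ι → Matrix (Fin 2) (Fin 2) ℂ))
    (hHs : ∀ X b, Hs X b - Matrix.trace (Hs X b) • (1 : Matrix (Fin 2) (Fin 2) ℂ) = Hs (fun c => X c - Matrix.trace (X c) • (1 : Matrix (Fin 2) (Fin 2) ℂ)) b)
    (C : (ι → Matrix (Fin 2) (Fin 2) ℂ) → (κ → Matrix (Fin 2) (Fin 2) ℂ)) {A' : ι → Matrix (Fin 2) (Fin 2) ℂ} (hA' : ∀ b, Matrix.trace (A' b) = 0)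
    {Dv : κ → Matrix (Fin 2) (Fin 2) ℂ} {t : ℝ}
    (hC : C (fun b => (A' - Hs Dv) b - Matrix.trace ((A' - Hs Dv) b) • (1 : Matrix (Fin 2) (Fin 2) ℂ)) =
      fun c => C (A' - Hs Dv) c - Matrix.trace (C (A' - Hs Dv) c) • (1 : Matrix (Fin 2) (Fin 2) ℂ))
    (h49 : C (A' - Hs Dv) = Dv) (hsizeπ : ∀ c, ‖Dv c - Matrix.trace (Dv c) • (1 : Matrix (Fin 2) (Fin 2) ℂ)‖ ≤ t)
    (huniq : ∀ D' : κ → Matrix (Fin 2) (Fin 2) ℂ, (∀ c, ‖D' c‖ ≤ t) → C (A' - Hs D') = D' → D' = Dv) :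
    (∀ c, Matrix.trace (Dv c) = 0) ∧ ∀ b, Matrix.trace ((A' - Hs Dv) b) = 0 := by
  -- the projected datum is a small solution too
  have hproj : ∀ D' : κ → Matrix (Fin 2) (Fin 2) ℂ, (fun b => (A' - Hs D') b - Matrix.trace ((A' - Hs D') b) • (1 : Matrix (Fin 2) (Fin 2) ℂ)) =
      A' - Hs (fun c => D' c - Matrix.trace (D' c) • (1 : Matrix (Fin 2) (Fin 2) ℂ)) := fun D' =>
    funext fun b => by rw [Pi.sub_apply, Pi.sub_apply, Matrix.trace_sub, hA' b, zero_sub, neg_smul, sub_neg_eq_add, ← hHs]; abel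
  have hsol : C (A' - Hs (fun c => Dv c - Matrix.trace (Dv c) • (1 : Matrix (Fin 2) (Fin 2) ℂ))) = fun c => Dv c - Matrix.trace (Dv c) • (1 : Matrix (Fin 2) (Fin 2) ℂ) := by
    rw [← hproj, hC, h49]
  have hfix : (fun c => Dv c - Matrix.trace (Dv c) • (1 : Matrix (Fin 2) (Fin 2) ℂ)) = Dv := huniq _ hsizeπ hsol
  have hDv : ∀ c, Matrix.trace (Dv c) = 0 := fun c => by
    have h := congrFun hfix c
    exact (smul_eq_zero.1 (sub_eq_self.1 h)).resolve_right one_ne_zero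
  refine ⟨hDv, fun b => ?_⟩
  have h := congrFun (hproj Dv) b
  rw [hfix] at h
  have h1 : Matrix.trace ((A' - Hs Dv) b) • (1 : Matrix (Fin 2) (Fin 2) ℂ) = 0 := sub_eq_self.1 h
  exact (smul_eq_zero.1 h1).resolve_right one_ne_zero

/-- ★★ **`hU` ON THE CHART OF RECORD**: for `C♭ = Q♭ − Q_lin` in ✓p616882 FILE E's (49)∕(55)∕uniqueness shapes, at a bondwise-TRACELESS `A′` whose dressed point lies in the weighted ball of record and
whose projected solution `Dv − (tr∘Dv)•1` stays in the uniqueness class (FILE E's sharp (55) on the half-ball + `norm_sub_trace_smul_one_le`), `Dv` and `A′ − Hs Dv` are traceless — so the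
dressed competitor is 𝔰𝔲(2)-valued and ✓`HalvingSU2ChartWitness.exists_su2Chart` charts it. [cite: Balaban1985Variational, (47)-(49) pp.285-286, (157)-(158) p.302] -/
theorem trace_dressed_chartOfRecord (F : T3Family) (n K : ℕ) (D : Domains (F.P K)) (hDk : D.k = K - n)
    (hcollar : ∀ (i : ℕ) (e : PBond (F.P K) (i + 1)), D.LamBond (i + 1) e → ∀ z : Site (F.P K) i, (blockOf z = e.src ∨ blockOf z = e.tgt) → z ∈ D.Om i)
    {w : ℕ → PBond (F.P K) 0 → ℝ} (hw : IsLevWeight F n K D w)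
    {R : ℝ} (hR : 16 * 3800 * ((((F.P K).d + 2) * (F.P K).L : ℕ) : ℝ) ^ 2 * (F.L : ℝ) * R ≤ 1)
    (Hs : (BondIdx D → Matrix (Fin 2) (Fin 2) ℂ) → (PBond (F.P K) 0 → Matrix (Fin 2) (Fin 2) ℂ))
    (hHs : ∀ X b, Hs X b - Matrix.trace (Hs X b) • (1 : Matrix (Fin 2) (Fin 2) ℂ) = Hs (fun c => X c - Matrix.trace (X c) • (1 : Matrix (Fin 2) (Fin 2) ℂ)) b)
    {A' : PBond (F.P K) 0 → Matrix (Fin 2) (Fin 2) ℂ} (hA' : ∀ b, Matrix.trace (A' b) = 0) {Dv : BondIdx D → Matrix (Fin 2) (Fin 2) ℂ} {t : ℝ}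
    (hball : ∀ b, w 1 b * ‖(A' - Hs Dv) b‖ < R)
    (h49 : chartLogFlat (((F.L : ℝ)⁻¹) ^ (K - n)) D (A' - Hs Dv) -
        (fderiv ℂ (chartLogFlat (((F.L : ℝ)⁻¹) ^ (K - n)) D : (PBond (F.P K) 0 → Matrix (Fin 2) (Fin 2) ℂ) → BondIdx D → Matrix (Fin 2) (Fin 2) ℂ) 0) (A' - Hs Dv) = Dv)
    (hsizeπ : ∀ c, ‖Dv c - Matrix.trace (Dv c) • (1 : Matrix (Fin 2) (Fin 2) ℂ)‖ ≤ t)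
    (huniq : ∀ D' : BondIdx D → Matrix (Fin 2) (Fin 2) ℂ, (∀ c, ‖D' c‖ ≤ t) →
      chartLogFlat (((F.L : ℝ)⁻¹) ^ (K - n)) D (A' - Hs D') -
        (fderiv ℂ (chartLogFlat (((F.L : ℝ)⁻¹) ^ (K - n)) D : (PBond (F.P K) 0 → Matrix (Fin 2) (Fin 2) ℂ) → BondIdx D → Matrix (Fin 2) (Fin 2) ℂ) 0) (A' - Hs D') = D' →
      D' = Dv) :
    (∀ c, Matrix.trace (Dv c) = 0) ∧ ∀ b, Matrix.trace ((A' - Hs Dv) b) = 0 := by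
  refine trace_dressed_eq_zero_of_unique Hs hHs
    (fun Y => chartLogFlat (((F.L : ℝ)⁻¹) ^ (K - n)) D Y -
      (fderiv ℂ (chartLogFlat (((F.L : ℝ)⁻¹) ^ (K - n)) D : (PBond (F.P K) 0 → Matrix (Fin 2) (Fin 2) ℂ) → BondIdx D → Matrix (Fin 2) (Fin 2) ℂ) 0) Y)
    hA' (funext fun c => ?_) h49 hsizeπ huniq
  rw [Pi.sub_apply, Pi.sub_apply, Matrix.trace_sub, sub_smul, chartLogFlat_traceProj_weightedBall₀ F n K D hDk hcollar hw hR hball c,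
    fderiv_chartLogFlat_zero_traceProj]
  abel

end Sigma

end Summit.QuantumFields.YangMills.Theorems.Prop8ChartDoubleBar

end
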